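import Summits.ABC.ABC.Theses.DefiniteXi
import Literature.NumberTheory.Automorphic.BrandtThetaSeriesHeckeAction
import Literature.NumberTheory.Automorphic.BrandtEigenvectorNonEisenstein
import Literature.NumberTheory.Automorphic.BrandtEigenvectorDegreeZero
import Literature.NumberTheory.Automorphic.BrandtHeckeProjector
import Literature.NumberTheory.Automorphic.BrandtMatrixDegree
import Literature.NumberTheory.EllipticCurves.CongruenceNumber
import Literature.NumberTheory.EllipticCurves.NewformsMultiplicityOneProofs
import Literature.NumberTheory.EllipticCurves.HeckeOperatorsModularFormQExpansion
import Literature.NumberTheory.EllipticCurves.HeckeOperatorsAdjointProofs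
import Literature.NumberTheory.EllipticCurves.RationalTwoTorsionModPIrreducibleProofs
import Literature.NumberTheory.EllipticCurves.NonEisensteinPrimeOfSurjective
import Literature.NumberTheory.EllipticCurves.SzpiroFreyConductorProofs
import Literature.NumberTheory.EllipticCurves.ModularCurveManinSemistableBridgeProofs
import Literature.NumberTheory.EllipticCurves.PastenSpectralDegreeProofs
import Literature.NumberTheory.EllipticCurves.PastenCongruenceModulusProofs
import HarnessLib

/-!
# Sketch (stub-ideation k=2 · GEN 2 · FAMILY 2 RESHAPE) for `stub_xiDegreeComparison` of crux
# `SteinbergCore` (route-ABC-DefiniteXi): THETA-LATTICE CONGRUENCE TRANSFER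
# `p^{v_p ξ} ∣ r_f (p ≥ 5)` ⟹ `cps ξ ∣ cps deg D` ⟹ the stub with `C = 1`.

Helper-lemma signatures (sorried) — they elaborate against the tree; the plan is
`STUB-IDEAS-stub_xiDegreeComparison-2.md`.  Gen-2 deltas over gen-1 (same namespace, this file
supersedes gen-1's): H2 packaged with linearity (H2b), H4 split into two independent
`Algebra.adjoin_induction`s (H4a on the modular side, NEW H4b = transport), H5 generalised in the
level (`hM : N⁺N⁻ = M`, kills the `Gamma0 (N/Nm*Nm)` vs `Gamma0 N` cast), NEW uniform packaged
form H5u, NEW guard `congruenceNumber D.f ≠ 0` (proved: junk-value catch), NEW H6a' (divisibility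
packaging from prime-power hypotheses), H1' = the prime-type special case of H1 (Pizer 2.15 verbatim).
-/

set_option linter.dupNamespace false

noncomputable section

namespace Summit.ABC.ABC.Cruxes.SteinbergCore.ThetaTransfer

open scoped MatrixGroups ModularForm Matrix
open CongruenceSubgroup
open Literature.NumberTheory.EllipticCurves Literature.NumberTheory.EllipticCurves.ModularForms
open Literature.NumberTheory.Automorphic Literature.NumberTheory.Automorphic.Brandt

/-! ## H1 — the one new NAMED FACT (to be typed in `Literature/NumberTheory/Automorphic/`) -/

/-- **H1 (named fact, Pizer 1980 Prop. 2.15 + Remark 2.16; Eichler 1973 Ch. II §6 Cor. 1 to Thm. 2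
and Ch. IV §1; Siegel's Hauptsatz / genus principle).** In row `i` of the Brandt theta matrix of a
definite Eichler-order setup the difference of two theta series is a cusp form:
`Θ_{ij} − Θ_{ik} ∈ S₂(Γ₀(N⁺N⁻))` (the norm forms on `I_j⁻¹I_i`, `I_k⁻¹I_i` lie in one genus, so
their theta series agree at every cusp). -/
def brandtTheta_sub_isCuspForm : Prop :=
  ∀ (Nplus Nminus : ℕ) (S : XiSetup Nplus Nminus) [Fintype (ClassSet S.O)] (i j k : ClassSet S.O),
    ModularForm.IsCuspForm (S.brandtTheta i j - S.brandtTheta i k)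

/-- **H1' (regime split, prime type — Pizer 1980 Prop. 2.15 VERBATIM: level `N⁺`, prime
discriminant `N⁻ = q`, no square-freeness of `N⁺` required).** The special case of H1 that the
stub needs when `Nm` is prime (`Odd (card primeFactors Nm)` with one factor); Frey levels
`2^e ∣ N⁺`, `e ≤ 8`, are covered. -/
def brandtTheta_sub_isCuspForm_prime : Prop :=
  ∀ (Nplus Nminus : ℕ), Nminus.Prime → ∀ (S : XiSetup Nplus Nminus) [Fintype (ClassSet S.O)]
    (i j k : ClassSet S.O), ModularForm.IsCuspForm (S.brandtTheta i j - S.brandtTheta i k)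

theorem brandtTheta_sub_isCuspForm.prime (h : brandtTheta_sub_isCuspForm) :
    brandtTheta_sub_isCuspForm_prime :=
  fun Nplus Nminus _ S _ i j k => h Nplus Nminus S i j k

/-! ## H2 — the integral theta lift `Θ_i : X⁰ → S₂(Γ₀(N⁺N⁻); ℤ)` and its Hecke equivariance -/

/-- **H2 (theta lift of degree-zero vectors).** From H1: for `v ∈ ℤ^{Cls O}` with `Σ_j v_j = 0`
the modular form `Σ_j v_j Θ_{ij} = Σ_{j} v_j (Θ_{ij} − Θ_{ij₁})` is a cusp form `Θ_i(v)` with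
integral `q`-expansion `a_n = 2 w_i (T(n) v)_i` (`XiSetup.qExpansion_coeff_sum_smul_brandtTheta`)
and `T_p Θ_i(v) = Θ_i(T(p) v)` for `p ∤ N⁺N⁻` (`XiSetup.modHeckeT_sum_smul_brandtTheta` +
`coe_modHeckeT_coe_cuspForm`; `T(p)` preserves degree zero by `XiSetup.sum_matrix_eq_sigma` +
`sum_mulVec_eq_mul_sum`).  Outside degree zero `Θ` is junk (say `0`). -/
theorem exists_thetaLift (hΘ : brandtTheta_sub_isCuspForm) {Nplus Nminus : ℕ}
    [NeZero (Nplus * Nminus)] (S : XiSetup Nplus Nminus) [Fintype (ClassSet S.O)]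
    (i : ClassSet S.O) :
    ∃ Θ : (ClassSet S.O → ℤ) → CuspForm (Gamma0 (Nplus * Nminus)) 2,
      ∀ v : ClassSet S.O → ℤ, ∑ j, v j = 0 →
        ((Θ v : ModularForm (Gamma0 (Nplus * Nminus)) 2) = ∑ j, (v j : ℂ) • S.brandtTheta i j) ∧
        Θ v ∈ integralCuspForms0 (Nplus * Nminus) 2 ∧
        (∀ n : ℕ, n ≠ 0 →
          cuspCoeff (Θ v) n = ((2 * (weight S.O i : ℤ) * (matrix S.O n *ᵥ v) i : ℤ) : ℂ)) ∧
        ∀ (p : ℕ) (hp : p.Prime), ¬ p ∣ Nplus * Nminus →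
          (haveI : NeZero p := ⟨hp.ne_zero⟩; heckeT (Gamma0 (Nplus * Nminus)) 2 p (Θ v)) =
            Θ (matrix S.O p *ᵥ v) := by
  sorry

/-- **H2b (linearity on `X⁰`, from the coercion formula alone; XS).**  Any `Θ` with
`(Θ v : M₂) = Σ_j v_j Θ_{ij}` on degree-zero `v` is additive and `ℤ`-homogeneous there
(injectivity of `CuspForm → ModularForm`). -/
theorem thetaLift_add_smul {Nplus Nminus : ℕ} [NeZero (Nplus * Nminus)] (S : XiSetup Nplus Nminus)
    [Fintype (ClassSet S.O)] (i : ClassSet S.O)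
    (Θ : (ClassSet S.O → ℤ) → CuspForm (Gamma0 (Nplus * Nminus)) 2)
    (hΘ : ∀ v : ClassSet S.O → ℤ, ∑ j, v j = 0 →
      ((Θ v : ModularForm (Gamma0 (Nplus * Nminus)) 2) = ∑ j, (v j : ℂ) • S.brandtTheta i j)) :
    (∀ v w : ClassSet S.O → ℤ, ∑ j, v j = 0 → ∑ j, w j = 0 → Θ (v + w) = Θ v + Θ w) ∧
    ∀ (c : ℤ) (v : ClassSet S.O → ℤ), ∑ j, v j = 0 → Θ (c • v) = (c : ℂ) • Θ v := by
  sorry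

/-! ## H3 — the eigen-line goes to `ℤ · f` EXACTLY (multiplicity one, proved in the tree) -/

/-- **H3 (image of the eigenvector).** If `φ` lies in the `a(W)`-eigen-lattice of the Brandt
matrices and `f` is the newform of `W` at level `N⁺N⁻`, then a cusp form `g` with
`(g : M₂) = Σ_j φ_j Θ_{ij}` equals `(2 w_i φ_i) • f`: `g` is a `T_p`-eigenform with the eigenvalues
of `f` for all `p ∤ N` (`modHeckeT_sum_smul_brandtTheta_of_eigenvector`), hence in `ℂ f` by
`mem_span_of_equiv_of_mem_newSubspace0` (Atkin–Lehner multiplicity one, PROVED), and the multiple is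
read off `a_1` (`qExpansion_coeff_one_sum_smul_brandtTheta`, `a_1(f) = 1`). -/
theorem thetaLift_eigenvector_eq_smul {Nplus Nminus : ℕ} [NeZero (Nplus * Nminus)]
    (S : XiSetup Nplus Nminus) [Fintype (ClassSet S.O)] (i : ClassSet S.O)
    (W : WeierstrassCurve ℚ) [W.IsElliptic] {f : CuspForm (Gamma0 (Nplus * Nminus)) 2}
    (hf : IsNewformOf W f) {φ : ClassSet S.O → ℤ}
    (hφ : φ ∈ eigenLattice (Nplus * Nminus) (matrix S.O) fun n => W.LFunction n)
    (g : CuspForm (Gamma0 (Nplus * Nminus)) 2)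
    (hg : (g : ModularForm (Gamma0 (Nplus * Nminus)) 2) = ∑ j, (φ j : ℂ) • S.brandtTheta i j) :
    g = (2 * (weight S.O i : ℂ) * (φ i : ℂ)) • f := by
  sorry

/-! ## H4 — orthogonality transfer `z ⊥_w φ ⟹ Θ_i(z) ⊥_{Pet} f`, as TWO independent inductions -/

/-- **H4a (eigen-pairing along the good Hecke algebra; modular side only).** For `f` with
`T_p f = a_p f` (`a_p ∈ ℤ`) for all `p ∤ N`, every `M` in the `ℤ`-algebra generated by these `T_p`
acts on `f` by an integer `c_M` and `⟨f, M g⟩ = c_M ⟨f, g⟩` for all `g` — `Algebra.adjoin_induction`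
with `heckeT_selfAdjoint_holds` (Knapp Thm. 9.18, PROVED) at each generator; no commutativity. -/
theorem exists_eigenvalue_peterssonProduct_eq {N : ℕ} [NeZero N] {k : ℤ}
    (f : CuspForm (Gamma0 N) k) (a : ℕ → ℤ)
    (hf : ∀ (p : ℕ) (hp : p.Prime), ¬ p ∣ N →
      (haveI : NeZero p := ⟨hp.ne_zero⟩; heckeT (Gamma0 N) k p f) = (a p : ℂ) • f)
    {M : Module.End ℂ (CuspForm (Gamma0 N) k)}
    (hM : M ∈ Algebra.adjoin ℤ {X : Module.End ℂ (CuspForm (Gamma0 N) k) |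
      ∃ (p : ℕ) (hp : p.Prime), ¬ p ∣ N ∧ X = (haveI : NeZero p := ⟨hp.ne_zero⟩; heckeT (Gamma0 N) k p)}) :
    ∃ c : ℤ, M f = (c : ℂ) • f ∧
      ∀ g, peterssonProduct (Gamma0 N) k f (M g) = (c : ℂ) * peterssonProduct (Gamma0 N) k f g := by
  sorry

/-- **H4b (NEW · transport of the good Brandt–Hecke algebra through an equivariant lift; pure
algebra, Brandt-free).**  If `Θ : ℤ^ι → S_k(Γ₀(N))` is additive and `ℤ`-homogeneous on the
degree-zero vectors and intertwines `T(p)` with `T_p` there for every prime `p ∤ N`, and the `T(p)`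
have constant column sums (so `ℤ[T(p) : p ∤ N]` preserves degree zero), then every
`M ∈ ℤ[T(p) : p ∤ N]` has a partner `M̃ ∈ ℤ[T_p : p ∤ N]` with `M̃ (Θ v) = Θ (M v)` on degree-zero
`v` — `Algebra.adjoin_induction` (generators: hypothesis; `+`, `*`, scalars: linearity). -/
theorem exists_transport_adjoin {ι : Type*} [Fintype ι] [DecidableEq ι] {N : ℕ} [NeZero N] {k : ℤ}
    (T : ℕ → Matrix ι ι ℤ) (hcol : ∀ p : ℕ, p.Prime → ¬ p ∣ N → ∃ s : ℤ, ∀ j, ∑ i, T p i j = s)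
    (Θ : (ι → ℤ) → CuspForm (Gamma0 N) k)
    (hadd : ∀ v w : ι → ℤ, ∑ j, v j = 0 → ∑ j, w j = 0 → Θ (v + w) = Θ v + Θ w)
    (hsmul : ∀ (c : ℤ) (v : ι → ℤ), ∑ j, v j = 0 → Θ (c • v) = (c : ℂ) • Θ v)
    (hT : ∀ (p : ℕ) (hp : p.Prime), ¬ p ∣ N → ∀ v : ι → ℤ, ∑ j, v j = 0 →
      (haveI : NeZero p := ⟨hp.ne_zero⟩; heckeT (Gamma0 N) k p (Θ v)) = Θ (T p *ᵥ v))
    {M : Matrix ι ι ℤ}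
    (hM : M ∈ Algebra.adjoin ℤ {X : Matrix ι ι ℤ | ∃ p : ℕ, p.Prime ∧ ¬ p ∣ N ∧ X = T p}) :
    ∃ Mt ∈ Algebra.adjoin ℤ {X : Module.End ℂ (CuspForm (Gamma0 N) k) |
        ∃ (p : ℕ) (hp : p.Prime), ¬ p ∣ N ∧ X = (haveI : NeZero p := ⟨hp.ne_zero⟩; heckeT (Gamma0 N) k p)},
      ∀ v : ι → ℤ, ∑ j, v j = 0 → Mt (Θ v) = Θ (M *ᵥ v) := by
  sorry

/-- **H4 (orthogonality transfer; now a ten-line corollary of H4a + H4b).** With `L = ℤφ` the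
eigen-line (`φ ≠ 0`, so `ξ = Σ w φ² > 0`) and `z` of degree zero with `⟨φ, z⟩_w = 0`:
`⟨f, Θ_i(z)⟩ = 0`.  Proof: the integral Hecke projector `M ∈ ℤ[T(p) : p ∤ N]`,
`ξ M_{cd} = D w_d φ_d φ_c`, `D > 0` (`Brandt.exists_heckeProjector` with `S.one_le_weight`,
`S.weight_mul_matrix_symm`) has `M z = 0`, `M φ = D φ`; its partner `M̃` (H4b) satisfies
`M̃ f = D f` (via H3: `Θ φ = m f`, `m ≠ 0`) so H4a gives `D ⟨f, Θ z⟩ = ⟨f, M̃ Θ z⟩ = ⟨f, Θ(Mz)⟩ = 0`. -/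
theorem peterssonProduct_thetaLift_eq_zero (hΘ : brandtTheta_sub_isCuspForm) {Nplus Nminus : ℕ}
    [NeZero (Nplus * Nminus)] (S : XiSetup Nplus Nminus) [Fintype (ClassSet S.O)]
    (i : ClassSet S.O) (W : WeierstrassCurve ℚ) [W.IsElliptic]
    {f : CuspForm (Gamma0 (Nplus * Nminus)) 2} (hf : IsNewformOf W f) {φ : ClassSet S.O → ℤ}
    (hφ0 : φ ≠ 0) (hL : eigenLattice (Nplus * Nminus) (matrix S.O) (fun n => W.LFunction n) = ℤ ∙ φ)
    (hφi : φ i ≠ 0)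
    {z : ClassSet S.O → ℤ} (hz0 : ∑ j, z j = 0)
    (hz : ∑ j, (weight S.O j : ℤ) * φ j * z j = 0)
    (g : CuspForm (Gamma0 (Nplus * Nminus)) 2)
    (hg : (g : ModularForm (Gamma0 (Nplus * Nminus)) 2) = ∑ j, (z j : ℂ) • S.brandtTheta i j) :
    peterssonProduct (Gamma0 (Nplus * Nminus)) 2 f g = 0 := by
  sorry

/-! ## H5 — the `p`-primary part of `ξ` divides the congruence number `r_f` (`p ≥ 5` non-Eisenstein) -/

/-- **H5 (theta congruence transfer, prime-wise; gen-2: level generalised by `hM`).** For every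
definite setup `S` of type `(N⁺, N⁻)`, every level `M = N⁺N⁻`, every elliptic `W/ℚ` with newform
`f ∈ S₂(Γ₀(M))`, every prime `p ≥ 5` admitting a good prime `ℓ` with `a_ℓ(W) ≢ ℓ + 1 (mod p)`:
`p^{v_p ξ_S(a(W))} ∣ r_f` (trivial if `v_p ξ = 0`, in particular for the junk value `ξ = 0`).
Chain (row `i := j₀`): `ξ = Σ w_j φ_j²` (`xi_eq_sum`); `j₀` with `p ∤ φ_{j₀}`
(`exists_not_dvd_of_eigenLattice_eq_span`), `p ∤ 2w_{j₀}` (`XiSetup.not_dvd_weight`); `Σφ = 0`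
(`XiSetup.sum_eq_zero_of_mem_eigenLattice_lFunction`, Hasse — unconditional); `y` of degree `0`
with `u = ⟨φ, y⟩_w` a `p`-unit (`XiSetup.exists_sum_eq_zero_not_dvd_pairing`); `z = ξ y − u φ` has
degree `0` and `⟨φ, z⟩_w = 0`; by H2/H2b/H3 `Θ z = ξ Θy − u m f`, `m = 2w_{j₀}φ_{j₀}` a `p`-unit;
Bezout `t u m = 1 + p^k s` gives `f − (−t Θz) = p^k • (t ξ' Θy − s f)` (`ξ = p^k ξ'`); H4 puts
`−tΘz` in `(ℤf)^⊥` (`mem_integralOrthogonal0`), `f ∈ S₂(ℤ)` (`hf`: `a_n ∈ ℤ`), so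
`dvd_congruenceNumber_of_sub_eq_smul` yields `p^k ∣ r_f`.  `subst hM` first. -/
theorem ordProj_xi_dvd_congruenceNumber (hΘ : brandtTheta_sub_isCuspForm) {Nplus Nminus M : ℕ}
    [NeZero M] (hM : Nplus * Nminus = M) (S : XiSetup Nplus Nminus) [Fintype (ClassSet S.O)]
    (W : WeierstrassCurve ℚ) [W.IsElliptic] {f : CuspForm (Gamma0 M) 2}
    (hf : IsNewformOf W f) {p : ℕ} (hp : p.Prime) (h5 : 5 ≤ p)
    (hℓ : ∃ ℓ : ℕ, ℓ.Prime ∧ ¬ ℓ ∣ M ∧ ¬ (p : ℤ) ∣ W.LFunction ℓ - (ℓ + 1)) :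
    p ^ (S.xi fun n => W.LFunction n).factorization p ∣ congruenceNumber f := by
  sorry

/-- **H5u (NEW · uniform packaged intermediate, bankable beyond Frey curves).** For ANY elliptic
`W/ℚ` of conductor `N⁺N⁻` with `ρ̄_{W,p}` irreducible for all `p ≥ 5`, any newform `f` of `W` at a
level `M = N⁺N⁻`, and any definite setup `S` of that type with `ξ ≠ 0`:
`cps ξ_S(a(W)) ∣ r_f` (prime-to-`6` parts).  From H5 at every `p ≥ 5` (witness `ℓ` by
`exists_prime_not_dvd_lFunction_sub_of_hasIrreducibleModPGaloisRep`, `hcond`) and H6a'. -/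
theorem primeToSix_xi_dvd_congruenceNumber (hΘ : brandtTheta_sub_isCuspForm)
    {Nplus Nminus M : ℕ} [NeZero M] (hM : Nplus * Nminus = M) (S : XiSetup Nplus Nminus)
    [Fintype (ClassSet S.O)] (W : WeierstrassCurve ℚ) [W.IsElliptic] (hcond : W.conductorNorm ℤ = M)
    (hirr : ∀ p : ℕ, p.Prime → 5 ≤ p → W.HasIrreducibleModPGaloisRep p)
    {f : CuspForm (Gamma0 M) 2} (hf : IsNewformOf W f) (hr : congruenceNumber f ≠ 0)
    (hξ : (S.xi fun n => W.LFunction n) ≠ 0) :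
    (S.xi fun n => W.LFunction n) / (ordProj[2] (S.xi fun n => W.LFunction n) *
        ordProj[3] (S.xi fun n => W.LFunction n)) ∣
      congruenceNumber f / (ordProj[2] (congruenceNumber f) * ordProj[3] (congruenceNumber f)) := by
  sorry

/-! ## Guard and `cps` bookkeeping -/

/-- **Guard (NEW, junk-value catch — PROVED here).** `congruenceNumber` is a `Nat.card` (junk `0`
for an infinite quotient); for the newform of a parametrisation datum it is `≠ 0`, because it
divides Pasten's positive product of congruence moduli (tree: Pasten 2024 §5.4–5.6). -/
theorem congruenceNumber_ne_zero {W : WeierstrassCurve ℚ} {N : ℕ} [NeZero N]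
    (D : ModularParametrizationData W N) : congruenceNumber D.f ≠ 0 :=
  (Nat.pos_of_dvd_of_pos D.congruenceNumber_dvd_prod_heckeCongruenceModulus
    D.prod_heckeCongruenceModulus_pos).ne'

/-- **H6a (`cps` divisibility from prime-wise domination at `p ≥ 5`; gen-1 form).** [folklore] -/
theorem primeToSix_dvd_of_factorization_le {x y : ℕ} (hy : y ≠ 0)
    (h : ∀ p : ℕ, p.Prime → 5 ≤ p → x.factorization p ≤ y.factorization p) :
    x / (ordProj[2] x * ordProj[3] x) ∣ y / (ordProj[2] y * ordProj[3] y) := by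
  sorry

/-- **H6a' (NEW · the packaging actually consumed: prime-power divisibilities ⟹ `cps x ∣ cps y`).**
`p ^ v_p(x) ∣ y`, `y ≠ 0` ⟹ `v_p x ≤ v_p y` (`Nat.Prime.pow_dvd_iff_le_factorization`), then H6a;
or directly `cps x = ∏_{p ≥ 5} p^{v_p x}` (`Nat.factorization_prod_pow_eq_self` minus `2, 3`). -/
theorem primeToSix_dvd_of_forall_prime_pow_dvd {x y : ℕ} (hy : y ≠ 0)
    (h : ∀ p : ℕ, p.Prime → 5 ≤ p → p ^ x.factorization p ∣ y) :
    x / (ordProj[2] x * ordProj[3] x) ∣ y / (ordProj[2] y * ordProj[3] y) := by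
  sorry

/-! ## H6 — assembly of the stub with `C = 1` -/

/-- **H6 (assembly): the stub with `C = 1`, uniformly in the type `(N/Nm, Nm)`,** from H1, the
Mazur–Kenku isogeny fact (`hasIrreducibleModPGaloisRep_freyCurve_of_mazurKenku` +
`exists_prime_not_dvd_lFunction_sub_of_hasIrreducibleModPGaloisRep`), ARS 2012 Thm. 2.1(b)
(`padicValNat_congruenceNumber_eq_of_not_sq_dvd` at the lattice-optimal datum `D₀` of
`D.exists_optimalDatum'`; `p² ∤ N` for `p ≥ 5` by `conductorNorm_freyCurve_dvd_holds`) and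
`FreyModularity` (`exists_minimal_datum`).  ORDER (gen-2): fix `ε`, `C := 1`; given `a b N Nm` and
`ξ ≠ 0`: `D` minimal, `D₀` optimal with `D₀.f = D.f`, `deg D₀ ∣ deg D` (verbatim the lines of
`xiDegreeComparison_of_facts`); `r := congruenceNumber D.f ≠ 0` (guard); setup `S` with
`brandtXi = S.xi` (`exists_brandtXi_eq`); PRIMEWISE for `p ≥ 5`: H5 (`hM : N/Nm*Nm = N` by
`Nat.div_mul_cancel`) ⟹ `p^{v_p ξ} ∣ r` ⟹ `v_p ξ ≤ v_p r = v_p deg D₀ ≤ v_p deg D`; H6a ⟹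
`cps ξ ∣ cps deg D` ⟹ `≤` (`Nat.le_of_dvd`, `cps deg D > 0`); finally `1 ≤ N^ε`, `1 ≤ T³`
(`factorization_minimalDiscriminantNorm_pos_of_dvd`) as in `xiDegreeComparison_of_facts`. -/
theorem stub_xiDegreeComparison_of_thetaTransfer (hΘ : brandtTheta_sub_isCuspForm)
    (hMK : mazurKenku_exists_cyclic_isogeny)
    (hARS : padicValNat_congruenceNumber_eq_of_not_sq_dvd)
    (hMod : Summit.ABC.ABC.Theses.DefiniteXi.FreyModularity) :
    ∀ ε : ℝ, 0 < ε → ∃ C : ℝ, ∀ a b : ℤ, IsCoprime a b → a * b * (a + b) ≠ 0 → ∀ (N : ℕ) [NeZero N],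
      (Literature.NumberTheory.EllipticCurves.freyCurve a b).conductorNorm ℤ = N →
      ∀ Nm : ℕ, Odd Nm → Squarefree Nm → Odd Nm.primeFactors.card → Nm ∣ N →
      Literature.NumberTheory.Automorphic.brandtXi (N / Nm) Nm
          (fun n => (Literature.NumberTheory.EllipticCurves.freyCurve a b).LFunction n) ≠ 0 →
      ∃ D : Literature.NumberTheory.EllipticCurves.ModularForms.ModularParametrizationData
        (Literature.NumberTheory.EllipticCurves.freyCurve a b) N,
        (∀ D' : Literature.NumberTheory.EllipticCurves.ModularForms.ModularParametrizationData
          (Literature.NumberTheory.EllipticCurves.freyCurve a b) N, D.deg ≤ D'.deg) ∧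
        ((Literature.NumberTheory.Automorphic.brandtXi (N / Nm) Nm
              (fun n => (Literature.NumberTheory.EllipticCurves.freyCurve a b).LFunction n) /
            (ordProj[2] (Literature.NumberTheory.Automorphic.brandtXi (N / Nm) Nm
                (fun n => (Literature.NumberTheory.EllipticCurves.freyCurve a b).LFunction n)) *
              ordProj[3] (Literature.NumberTheory.Automorphic.brandtXi (N / Nm) Nm
                (fun n => (Literature.NumberTheory.EllipticCurves.freyCurve a b).LFunction n))) : ℕ) : ℝ) ≤
          C * (N : ℝ) ^ ε * ((D.deg / (ordProj[2] D.deg * ordProj[3] D.deg) : ℕ) : ℝ) *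
            ((∏ q ∈ N.primeFactors, ((Literature.NumberTheory.EllipticCurves.freyCurve a b).minimalDiscriminantNorm
              ℤ).factorization q : ℕ) : ℝ) ^ 3 := by
  sorry

/-- **H6' (regime split on the type): the PRIME-type stub instance needs only H1'.**  Same
statement with the extra hypothesis `Nm.Prime`; identical assembly. (Stated to let the prime-type
regime close on Pizer 2.15 verbatim while the composite-type H1 is being typed.) -/
theorem stub_xiDegreeComparison_primeType_of_thetaTransfer (hΘ : brandtTheta_sub_isCuspForm_prime)
    (hMK : mazurKenku_exists_cyclic_isogeny)
    (hARS : padicValNat_congruenceNumber_eq_of_not_sq_dvd)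
    (hMod : Summit.ABC.ABC.Theses.DefiniteXi.FreyModularity) :
    ∀ ε : ℝ, 0 < ε → ∃ C : ℝ, ∀ a b : ℤ, IsCoprime a b → a * b * (a + b) ≠ 0 → ∀ (N : ℕ) [NeZero N],
      (Literature.NumberTheory.EllipticCurves.freyCurve a b).conductorNorm ℤ = N →
      ∀ Nm : ℕ, Nm.Prime → Odd Nm → Squarefree Nm → Odd Nm.primeFactors.card → Nm ∣ N →
      Literature.NumberTheory.Automorphic.brandtXi (N / Nm) Nm
          (fun n => (Literature.NumberTheory.EllipticCurves.freyCurve a b).LFunction n) ≠ 0 →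
      ∃ D : Literature.NumberTheory.EllipticCurves.ModularForms.ModularParametrizationData
        (Literature.NumberTheory.EllipticCurves.freyCurve a b) N,
        (∀ D' : Literature.NumberTheory.EllipticCurves.ModularForms.ModularParametrizationData
          (Literature.NumberTheory.EllipticCurves.freyCurve a b) N, D.deg ≤ D'.deg) ∧
        ((Literature.NumberTheory.Automorphic.brandtXi (N / Nm) Nm
              (fun n => (Literature.NumberTheory.EllipticCurves.freyCurve a b).LFunction n) /
            (ordProj[2] (Literature.NumberTheory.Automorphic.brandtXi (N / Nm) Nm
                (fun n => (Literature.NumberTheory.EllipticCurves.freyCurve a b).LFunction n)) *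
              ordProj[3] (Literature.NumberTheory.Automorphic.brandtXi (N / Nm) Nm
                (fun n => (Literature.NumberTheory.EllipticCurves.freyCurve a b).LFunction n))) : ℕ) : ℝ) ≤
          C * (N : ℝ) ^ ε * ((D.deg / (ordProj[2] D.deg * ordProj[3] D.deg) : ℕ) : ℝ) *
            ((∏ q ∈ N.primeFactors, ((Literature.NumberTheory.EllipticCurves.freyCurve a b).minimalDiscriminantNorm
              ℤ).factorization q : ℕ) : ℝ) ^ 3 := by
  sorry

end Summit.ABC.ABC.Cruxes.SteinbergCore.ThetaTransfer

end
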